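import Mathlib
import Summits.ValiantsHypothesis.ValiantsHypothesis.Theorems.ValuativeGCTValuativeFlipCyclicTridiagonalUnrolled

/-!
# Cofactors of a cyclic tridiagonal matrix, unrolled form — the sum formula (crux
# `ValuativeGCT.ValuativeFlip`, stub `stub_fourRowPencilRank`, part P1 of the cyclic-tridiagonal
# architecture)

Helper file (`--supports stmt-ValiantsHypothesis-12624`).  Assembly of the two minors computed in
`…CyclicTridiagonalUnrolled` (`ct_permanent_term1`, `ct_permanent_term2_inner`,
`ct_permanent_term2_top`) into the closed form of the permanent of the unrolled cofactor matrix: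

  `per (ctU L M M' (k+2) d) = (∏_{a<d} M (k+2-d+a)) · K_{k+2-d} + (∏_{x<k+3-d} M' x) · K_{d-1}(shift k+3-d)`

(`ct_permanent_ctU`; `T_ij + S_ij` of `Cruxes/ValuativeFlip/AxisK9G1a2CyclicTridiagonal.md` §2 in
unrolled coordinates): Laplace along the row of `j` (entries `m_j`, `m'_j`), then along the column
of `i` inside the `m'_j`-minor (entries `m'_{i+1}` and the leak `m_{i-1}`, whose minor dies by
Frobenius–König).
-/

set_option linter.dupNamespace false

namespace Summit.ValiantsHypothesis.ValiantsHypothesis.Theorems.ValuativeFlip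

open scoped BigOperators Matrix
open Finset

variable {R : Type*} [CommRing R]

section Main

variable (L M M' : ℕ → R)

/-- **Permanent of the unrolled cofactor matrix**: clockwise string × continuant of the
complementary arc + counter-clockwise string × continuant of its complementary arc,
`per (ctU L M M' (k+2) d) = (∏_{a<d} M (k+2-d+a)) · K_{k+2-d} + (∏_{x<k+3-d} M' x) · K_{d-1}(shift k+3-d)`
for `1 ≤ d ≤ k + 2` (`Cruxes/ValuativeFlip/AxisK9G1a2CyclicTridiagonal.md` §2, `f_ij = T_ij + S_ij`,
in unrolled coordinates). [this crux] -/
theorem ct_permanent_ctU (k d : ℕ) (hd₁ : 1 ≤ d) (hd : d ≤ k + 2) :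
    (ctU L M M' (k + 2) d).permanent =
      (∏ a ∈ Finset.range d, M (k + 2 - d + a)) * ctK L M M' (k + 2 - d) +
        (∏ x ∈ Finset.range (k + 3 - d), M' x) *
          ctK (fun t => L (k + 3 - d + t)) (fun t => M (k + 3 - d + t)) (fun t => M' (k + 3 - d + t))
            (d - 1) := by
  set U := ctU L M M' (k + 2) d with hU
  set r₀ : Fin (k + 2) := ⟨k + 2 - d, by omega⟩ with hr₀
  have hr₀v : (r₀ : ℕ) = k + 2 - d := rfl
  -- Laplace along the row of `j`
  have hzero : ∀ y : Fin (k + 2), y ∉ ({0, Fin.last (k + 1)} : Finset (Fin (k + 2))) → U r₀ y = 0 := by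
    intro y hy
    simp only [Finset.mem_insert, Finset.mem_singleton, not_or] at hy
    have hy0 : (y : ℕ) ≠ 0 := fun h => hy.1 (Fin.ext (by simpa using h))
    have hy1 : (y : ℕ) ≠ k + 1 := fun h => hy.2 (Fin.ext (by simpa using h))
    have hyl : (y : ℕ) < k + 2 := y.isLt
    exact ctU_apply_zero L M M' (k + 2) d (by omega) (by omega) (by omega)
  have h0l : (0 : Fin (k + 2)) ≠ Fin.last (k + 1) := fun h => by
    have := congrArg Fin.val h
    simp at this
  rw [Matrix.permanent_eq_sum_row_subset U r₀ _ hzero, Finset.sum_pair h0l]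
  have e0 : U r₀ 0 = M (k + 2 - d) := by
    rw [hU, ctU_apply_M L M M' (k + 2) d (by simp only [Fin.val_zero]; omega)
      (by simp only [Fin.val_zero]; omega)]
  have el : U r₀ (Fin.last (k + 1)) = M' (k + 2 - d) := by
    rw [hU, ctU_apply_M' L M M' (k + 2) d (by simp only [Fin.val_last]; omega)
      (by simp only [Fin.val_last]; omega) (by simp only [Fin.val_last]; omega)]
  rw [e0, el, Fin.succAbove_zero, Fin.succAbove_last, hU, ct_permanent_term1 L M M' k d hd₁ hd r₀ hr₀v]
  -- the clockwise part
  have hT : M (k + 2 - d) * (ctK L M M' (k + 2 - d) * ∏ a ∈ Finset.range (d - 1), M (k + 3 - d + a)) =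
      (∏ a ∈ Finset.range d, M (k + 2 - d + a)) * ctK L M M' (k + 2 - d) := by
    obtain ⟨d', rfl⟩ : ∃ d', d = d' + 1 := ⟨d - 1, by omega⟩
    rw [Finset.prod_range_succ', show d' + 1 - 1 = d' from rfl, add_zero]
    rw [Finset.prod_congr rfl fun (a : ℕ) (_ : a ∈ Finset.range d') =>
      (show M (k + 3 - (d' + 1) + a) = M (k + 2 - (d' + 1) + (a + 1)) by congr 1; omega)]
    ring
  rw [hT, add_right_inj]
  -- the counter-clockwise part
  by_cases htop : d = k + 2
  · subst htop
    have hr0 : r₀ = 0 := Fin.ext (by simp [hr₀v])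
    rw [hr0, ct_permanent_term2_top]
    have e1 : k + 3 - (k + 2) = 1 := by omega
    have e2 : k + 2 - (k + 2) = 0 := by omega
    simp only [e1, e2, Finset.prod_range_one, show k + 2 - 1 = k + 1 from rfl]
  have hdk : d ≤ k + 1 := by omega
  -- Laplace along the column of `i`
  set T₂ := (ctU L M M' (k + 2) d).submatrix r₀.succAbove Fin.castSucc with hT₂
  have hc : d - 1 < k + 1 := by omega
  rw [Matrix.permanent_eq_sum_column T₂ ⟨d - 1, hc⟩, Fin.sum_univ_succ]
  have hrest : ∑ x : Fin k, T₂ x.succ ⟨d - 1, hc⟩ *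
      (T₂.submatrix x.succ.succAbove (Fin.succAbove ⟨d - 1, hc⟩)).permanent = 0 := by
    refine Finset.sum_eq_zero fun x _ => ?_
    have hxk : (x : ℕ) < k := x.isLt
    by_cases hx : (x : ℕ) + 1 < k + 2 - d
    · -- rows strictly between `i + 1` and `j`: zero entry in the column of `i`
      have hv := ct_val_succAbove_of_lt r₀ x.succ (by simp only [Fin.val_succ, hr₀v]; omega)
      simp only [Fin.val_succ] at hv
      rw [hT₂, Matrix.submatrix_apply, ctU_apply_zero L M M' (k + 2) d
        (by simp only [Fin.val_castSucc]; omega) (by simp only [Fin.val_castSucc]; omega)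
        (by simp only [Fin.val_castSucc]; omega), zero_mul]
    · have hv := ct_val_succAbove_of_le r₀ x.succ (by simp only [Fin.val_succ, hr₀v]; omega)
      simp only [Fin.val_succ] at hv
      by_cases hxl : (x : ℕ) + 1 = k
      · -- the row of `i - 1`: entry `m_{i-1}`, but the minor dies by Frobenius–König
        have hle : k + 2 - d ≤ k := by omega
        have hxlast : x.succ = Fin.last k := Fin.ext (by simp; omega)
        have hminor : (T₂.submatrix x.succ.succAbove (Fin.succAbove ⟨d - 1, hc⟩)).permanent = 0 := by
          refine ct_permanent_eq_zero_of_confined _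
            ((Finset.univ : Finset (Fin (k + 2 - d))).image (Fin.castLE hle))
            ((Finset.univ : Finset (Fin (k + 1 - d))).image
              fun c : Fin (k + 1 - d) => (⟨d - 1 + (c : ℕ), by omega⟩ : Fin k)) ?_ ?_
          · rw [Finset.card_image_of_injective _ (Fin.castLE_injective _),
              Finset.card_image_of_injective _ (by
                intro a b h
                have := congrArg Fin.val h
                exact Fin.ext (by simpa using this))]
            simp only [Finset.card_univ, Fintype.card_fin]
            omega
          · intro r hr c hcT
            obtain ⟨r', -, rfl⟩ := Finset.mem_image.mp hr
            have hcv : (c : ℕ) < d - 1 := by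
              by_contra hcn
              exact hcT (Finset.mem_image.mpr ⟨⟨c - (d - 1), by omega⟩, Finset.mem_univ _,
                Fin.ext (by simp; omega)⟩)
            simp only [Matrix.submatrix_apply, hT₂, hxlast, Fin.succAbove_last]
            have h1 := ct_val_succAbove_of_lt r₀ (Fin.castSucc (Fin.castLE hle r'))
              (by simp only [Fin.val_castSucc, Fin.val_castLE, hr₀v]; exact r'.isLt)
            have h2 := ct_val_succAbove_of_lt (⟨d - 1, hc⟩ : Fin (k + 1)) c hcv
            simp only [Fin.val_castSucc, Fin.val_castLE] at h1
            have hr'lt : (r' : ℕ) < k + 2 - d := r'.isLt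
            exact ctU_apply_zero L M M' (k + 2) d (by simp only [Fin.val_castSucc]; omega)
              (by simp only [Fin.val_castSucc]; omega) (by simp only [Fin.val_castSucc]; omega)
        rw [hminor, mul_zero]
      · rw [hT₂, Matrix.submatrix_apply, ctU_apply_zero L M M' (k + 2) d
          (by simp only [Fin.val_castSucc]; omega) (by simp only [Fin.val_castSucc]; omega)
          (by simp only [Fin.val_castSucc]; omega), zero_mul]
  rw [hrest, add_zero]
  have e00 : T₂ 0 ⟨d - 1, hc⟩ = M' 0 := by
    have hv := ct_val_succAbove_of_lt r₀ 0 (by simp only [Fin.val_zero, hr₀v]; omega)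
    simp only [Fin.val_zero] at hv
    rw [hT₂, Matrix.submatrix_apply, ctU_apply_M' L M M' (k + 2) d
      (by simp only [Fin.val_castSucc]; omega) (by simp only [Fin.val_castSucc]; omega)
      (by simp only [Fin.val_castSucc]; omega), hv]
  rw [e00, Fin.succAbove_zero, hT₂, ct_permanent_term2_inner L M M' k d hd₁ hdk r₀ hr₀v]
  have e3 : k + 3 - d = (k + 1 - d) + 1 + 1 := by omega
  rw [e3, Finset.prod_range_succ, Finset.prod_range_succ']
  have e4 : k + 1 - d + 1 = k + 2 - d := by omega
  simp only [e4]
  ring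

end Main

end Summit.ValiantsHypothesis.ValiantsHypothesis.Theorems.ValuativeFlip
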